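import Summits.Ventures.Crystal3D.Theorems.StickyWulffConstantGenericWallFloorHRowEndModel
import Summits.Ventures.Crystal3D.Theorems.StickyWulffConstantGenericWallFloorStackLedgerLocalTools
import HarnessLib

/-!
# The dozen of a strongly certified predecessor, unified (full = twin with normal `0`), and the VERTICAL-PAIR lemma
# (crux `GenericWallFloor`, stmt-Ventures-19480, kernel G; brick of TRACK 2′ = the structural proof of `HRowEndFarApart (3/4)`; 19480-p2 g14)

HONEST FRAMING. Venture `Summits/Ventures/Crystal3D` (cell `crystal3d-full`), route `route-Ventures-StickyWulffConstant`, helper for the crux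
`GenericWallFloor` (stmt-Ventures-19480) / consumer `TextureLiminfV5` (stmt-Ventures-23912).  One bookkeeping definition (`InDoz`) and three lemmas;
standard axioms; F-C1 not moved.
* `InDoz F′ n₀ v` — `v` is a dozen vector of a ball certified in the frame `F′` with twin normal `n₀` (`n₀ = 0`: FULL): a slot `F′ w` with `⟪F′ w, n₀⟫ ≥ 0`
  or a lowered capper `F′ w − 2√(2/3)·n₀` with `⟪F′ w, n₀⟫ > 0`;
* `dozen_of_certified12` — from `WalkCertified12 X e ⟨F′, q, 0⟩`: such an `n₀` with the menu, `⟪F′ q, n₀⟫ ≥ 0` (`> 0` unless `n₀ = 0`), `e − F′ q ∈ X`,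
  and the √2-GAP: every `x ∈ X` within `√2` of `e − F′ q`, `x ≠ e − F′ q`, has `InDoz F′ n₀ (x − (e − F′ q))` (…KissingGap);
* `vertical_pair` — two dozen vectors at inner product `−1/3` are never two slots; they are a slot and its lowered copy, so their difference is
  `±2√(2/3)·n₀` and `n₀` is a genuine cap normal;  `slot_of_sub_unit` — a dozen vector at unit distance from a vector reading `≥ √(2/3)` against
  `n₀` is a slot (not lowered).
-/

noncomputable section

namespace Summit.Ventures.Crystal3D.Theorems

open Finset
open Literature.MathematicalPhysics.StatisticalMechanics
open scoped InnerProductSpace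

namespace HRowEndModel

variable {X : Finset (EuclideanSpace ℝ (Fin 3))}

/-- `v` is a DOZEN VECTOR of a ball certified in the frame `F′` with twin normal `n₀` (`n₀ = 0` encodes the full cuboctahedral dozen). -/
def InDoz (F' : EuclideanSpace ℝ (Fin 3) ≃ₗᵢ[ℝ] EuclideanSpace ℝ (Fin 3)) (n₀ v : EuclideanSpace ℝ (Fin 3)) : Prop :=
  ∃ w ∈ fccSlots, (0 ≤ ⟪F' w, n₀⟫_ℝ ∧ v = F' w) ∨ (0 < ⟪F' w, n₀⟫_ℝ ∧ v = F' w - (2 * Real.sqrt (2 / 3)) • n₀)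

/-- **The dozen of a strongly certified predecessor, unified.** -/
theorem dozen_of_certified12 (hX : ∀ p ∈ X, ∀ q ∈ X, p ≠ q → 1 ≤ dist p q)
    {F' : EuclideanSpace ℝ (Fin 3) ≃ₗᵢ[ℝ] EuclideanSpace ℝ (Fin 3)} {q e : EuclideanSpace ℝ (Fin 3)}
    (hcert : WalkCertified12 X e ⟨F', q, 0⟩) :
    ∃ n₀ : EuclideanSpace ℝ (Fin 3), (n₀ = 0 ∨ ‖n₀‖ = 1) ∧
      (∀ w ∈ fccSlots, ⟪F' w, n₀⟫_ℝ = 0 ∨ ⟪F' w, n₀⟫_ℝ = Real.sqrt (2 / 3) ∨ ⟪F' w, n₀⟫_ℝ = -Real.sqrt (2 / 3)) ∧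
      0 ≤ ⟪F' q, n₀⟫_ℝ ∧ (n₀ = 0 ∨ 0 < ⟪F' q, n₀⟫_ℝ) ∧ e - F' q ∈ X ∧
      ∀ x ∈ X, x ≠ e - F' q → dist x (e - F' q) < Real.sqrt 2 → InDoz F' n₀ (x - (e - F' q)) := by
  rcases hcert with ⟨hd, hsh⟩ | ⟨n₀, hn, hmenu, hpos, hd, hocc, hlow⟩
  · dsimp only at hd hsh
    refine ⟨0, Or.inl rfl, fun w _ => Or.inl (by simp), by simp, Or.inl rfl, hd, fun x hx hne hdist => ?_⟩
    obtain ⟨w, hw, hxw⟩ := mem_fullDozen_of_dist_lt_sqrt_two hX hsh hx hne hdist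
    exact ⟨w, hw, Or.inl ⟨by simp, by rw [hxw]; abel⟩⟩
  · dsimp only at hmenu hpos hd hocc hlow
    refine ⟨n₀, Or.inr hn, hmenu, hpos.le, Or.inr hpos, hd, fun x hx hne hdist => ?_⟩
    obtain ⟨w, hw, hwn, hcase⟩ := mem_capDozen_of_dist_lt_sqrt_two hX hn hmenu hocc hlow hx hne hdist
    refine ⟨w, hw, ?_⟩
    rcases hcase with h | ⟨hp, h⟩
    · exact Or.inl ⟨hwn, by rw [h]; abel⟩
    · exact Or.inr ⟨hp, by rw [h]; abel⟩

/-- The menu of two slots never reads `−1/3`. -/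
theorem inner_slots_ne_third {w w' : EuclideanSpace ℝ (Fin 3)} (hw : w ∈ fccSlots) (hw' : w' ∈ fccSlots) : ⟪w, w'⟫_ℝ ≠ -1 / 3 := by
  intro h
  rcases inner_slots_mem hw hw' with h' | h' | h' | h' | h' <;> rw [h'] at h <;> norm_num at h

/-- A positive reading is exactly `√(2/3)`, and then the normal is a unit vector. -/
theorem reading_of_pos {F' : EuclideanSpace ℝ (Fin 3) ≃ₗᵢ[ℝ] EuclideanSpace ℝ (Fin 3)} {n₀ : EuclideanSpace ℝ (Fin 3)} (hn : n₀ = 0 ∨ ‖n₀‖ = 1)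
    (hmenu : ∀ w ∈ fccSlots, ⟪F' w, n₀⟫_ℝ = 0 ∨ ⟪F' w, n₀⟫_ℝ = Real.sqrt (2 / 3) ∨ ⟪F' w, n₀⟫_ℝ = -Real.sqrt (2 / 3))
    {w : EuclideanSpace ℝ (Fin 3)} (hw : w ∈ fccSlots) (h : 0 < ⟪F' w, n₀⟫_ℝ) : ⟪F' w, n₀⟫_ℝ = Real.sqrt (2 / 3) ∧ ‖n₀‖ = 1 := by
  have hc : 0 < Real.sqrt (2 / 3) := Real.sqrt_pos.2 (by norm_num)
  have h1 : ⟪F' w, n₀⟫_ℝ = Real.sqrt (2 / 3) := by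
    rcases hmenu w hw with h' | h' | h'
    · rw [h'] at h; exact absurd h (lt_irrefl 0)
    · exact h'
    · rw [h'] at h; linarith
  refine ⟨h1, ?_⟩
  rcases hn with h0 | h0
  · rw [h0, inner_zero_right] at h; exact absurd h (lt_irrefl 0)
  · exact h0

/-- **VERTICAL PAIR.**  Two dozen vectors `F a`, `F b` with `⟪a, b⟫ = −1/3`: a slot and its own lowered copy, so `F a − F b = ±2√(2/3)·n₀` with a
positive slot present (hence `n₀ ≠ 0`). -/
theorem vertical_pair {F F' : EuclideanSpace ℝ (Fin 3) ≃ₗᵢ[ℝ] EuclideanSpace ℝ (Fin 3)} {n₀ a b : EuclideanSpace ℝ (Fin 3)}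
    (hn : n₀ = 0 ∨ ‖n₀‖ = 1)
    (hmenu : ∀ w ∈ fccSlots, ⟪F' w, n₀⟫_ℝ = 0 ∨ ⟪F' w, n₀⟫_ℝ = Real.sqrt (2 / 3) ∨ ⟪F' w, n₀⟫_ℝ = -Real.sqrt (2 / 3))
    (hab : ⟪a, b⟫_ℝ = -1 / 3) (hA : InDoz F' n₀ (F a)) (hB : InDoz F' n₀ (F b)) :
    ∃ c : ℝ, (c = 1 ∨ c = -1) ∧ F a - F b = (c * (2 * Real.sqrt (2 / 3))) • n₀ ∧ ∃ w ∈ fccSlots, 0 < ⟪F' w, n₀⟫_ℝ := by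
  have h23 : Real.sqrt (2 / 3) * Real.sqrt (2 / 3) = 2 / 3 := Real.mul_self_sqrt (by norm_num)
  obtain ⟨w, hw, hwA⟩ := hA
  obtain ⟨w', hw', hwB⟩ := hB
  have hFab : ⟪F a, F b⟫_ℝ = -1 / 3 := by rw [LinearIsometryEquiv.inner_map_map]; exact hab
  have slot_eq : ⟪w, w'⟫_ℝ = 1 → w = w' := fun hww => by
    have : ‖w - w'‖ ^ 2 = 0 := by
      rw [@norm_sub_sq_real, norm_eq_one_of_mem_fccSlots hw, norm_eq_one_of_mem_fccSlots hw', hww]; ring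
    rw [sq_eq_zero_iff, norm_eq_zero, sub_eq_zero] at this; exact this
  rcases hwA with ⟨hw0, hwa⟩ | ⟨hwpos, hwa⟩ <;> rcases hwB with ⟨hw0', hwb⟩ | ⟨hwpos', hwb⟩
  · exfalso
    rw [hwa, hwb, LinearIsometryEquiv.inner_map_map] at hFab
    exact inner_slots_ne_third hw hw' hFab
  · obtain ⟨hval', hn1⟩ := reading_of_pos hn hmenu hw' hwpos'
    have hnn : ⟪n₀, n₀⟫_ℝ = 1 := by rw [real_inner_self_eq_norm_sq, hn1, one_pow]
    rw [hwa, hwb, inner_sub_right, real_inner_smul_right, LinearIsometryEquiv.inner_map_map] at hFab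
    rcases hmenu w hw with h0 | h0 | h0
    · rw [h0] at hFab; exact absurd (by linarith : ⟪w, w'⟫_ℝ = -1 / 3) (inner_slots_ne_third hw hw')
    · rw [h0] at hFab
      have hww : ⟪w, w'⟫_ℝ = 1 := by nlinarith [hFab, h23]
      have := slot_eq hww; subst this
      exact ⟨1, Or.inl rfl, by rw [hwa, hwb]; simp, w, hw, hwpos'⟩
    · rw [h0] at hw0
      have hc : 0 < Real.sqrt (2 / 3) := Real.sqrt_pos.2 (by norm_num)
      linarith
  · obtain ⟨hval, hn1⟩ := reading_of_pos hn hmenu hw hwpos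
    have hnn : ⟪n₀, n₀⟫_ℝ = 1 := by rw [real_inner_self_eq_norm_sq, hn1, one_pow]
    rw [hwa, hwb, inner_sub_left, real_inner_smul_left, LinearIsometryEquiv.inner_map_map, real_inner_comm (F' w') n₀] at hFab
    rcases hmenu w' hw' with h0 | h0 | h0
    · rw [h0] at hFab; exact absurd (by linarith : ⟪w, w'⟫_ℝ = -1 / 3) (inner_slots_ne_third hw hw')
    · rw [h0] at hFab
      have hww : ⟪w, w'⟫_ℝ = 1 := by nlinarith [hFab, h23]
      have := slot_eq hww; subst this
      refine ⟨-1, Or.inr rfl, ?_, w, hw, hwpos⟩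
      rw [hwa, hwb]
      simp only [neg_mul, one_mul, neg_smul]
      abel
    · rw [h0] at hw0'
      have hc : 0 < Real.sqrt (2 / 3) := Real.sqrt_pos.2 (by norm_num)
      linarith
  · exfalso
    obtain ⟨hval, hn1⟩ := reading_of_pos hn hmenu hw hwpos
    obtain ⟨hval', -⟩ := reading_of_pos hn hmenu hw' hwpos'
    have hnn : ⟪n₀, n₀⟫_ℝ = 1 := by rw [real_inner_self_eq_norm_sq, hn1, one_pow]
    rw [hwa, hwb, inner_sub_left, inner_sub_right, inner_sub_right, real_inner_smul_left, real_inner_smul_left, real_inner_smul_right,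
      real_inner_smul_right, LinearIsometryEquiv.inner_map_map, real_inner_comm (F' w') n₀, hval, hval', hnn] at hFab
    have : ⟪w, w'⟫_ℝ = -1 / 3 := by nlinarith [hFab, h23]
    exact inner_slots_ne_third hw hw' this

/-- **A dozen vector at unit distance from a vector reading `≥ √(2/3)` is a slot** (a lowered vector reads `−√(2/3)`, too far below). -/
theorem slot_of_sub_unit {F' : EuclideanSpace ℝ (Fin 3) ≃ₗᵢ[ℝ] EuclideanSpace ℝ (Fin 3)} {n₀ v x : EuclideanSpace ℝ (Fin 3)}
    (hn : n₀ = 0 ∨ ‖n₀‖ = 1)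
    (hmenu : ∀ w ∈ fccSlots, ⟪F' w, n₀⟫_ℝ = 0 ∨ ⟪F' w, n₀⟫_ℝ = Real.sqrt (2 / 3) ∨ ⟪F' w, n₀⟫_ℝ = -Real.sqrt (2 / 3))
    (hv : Real.sqrt (2 / 3) ≤ ⟪v, n₀⟫_ℝ) (hxv : ‖x - v‖ = 1) (hx : InDoz F' n₀ x) :
    ∃ w ∈ fccSlots, x = F' w := by
  obtain ⟨w, hw, h⟩ := hx
  rcases h with ⟨-, hxw⟩ | ⟨hpos, hxw⟩
  · exact ⟨w, hw, hxw⟩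
  · exfalso
    have h23 : Real.sqrt (2 / 3) * Real.sqrt (2 / 3) = 2 / 3 := Real.mul_self_sqrt (by norm_num)
    obtain ⟨hval, hn1⟩ := reading_of_pos hn hmenu hw hpos
    have hnn : ⟪n₀, n₀⟫_ℝ = 1 := by rw [real_inner_self_eq_norm_sq, hn1, one_pow]
    have hxn : ⟪x, n₀⟫_ℝ = -Real.sqrt (2 / 3) := by
      rw [hxw, inner_sub_left, real_inner_smul_left, hval, hnn]; ring
    have h1 := abs_real_inner_le_norm (x - v) n₀
    rw [hxv, hn1, one_mul, inner_sub_left, hxn] at h1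
    have h2 := (abs_le.1 h1).1
    nlinarith [h23]

end HRowEndModel

end Summit.Ventures.Crystal3D.Theorems

end
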